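import Summits.QuantumFields.YangMills.Theorems.BalabanUVNodesN07SplitClauseOfShearSize
import HarnessLib

/-!
# N07 [B11] (= [15] = [Balaban1985Variational]) Sect. F, road of record R0′, WIDTH-209 row (r2), FILE 9: **THE S6 HEAD's R0′ SPLIT CLAUSE AT THE RECORD,
# KEYED ON THE SHEAR's VARIATION LETTER `ς`** — the socket a PER-BOND (hierarchical, radial-tower) supplier plugs into; FILE 7 §3 ∕ FILE 8's
# «box-sup letter × walk length» supplier recovered as the short-tower instance

Cell `pub-ymgap`, width seat `pub-ymgap-dag-n07-w8` g5, WIDTH-209 N07 row (r2) of road R0′, CLAIM-9 ∕ INTENT-9 (cell bus I.36833; own lineage FILE 7 p625131 ✓ ∕ FILE 8 p627069 ✓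
→ FILE 9) + LOCATED-CRUDE-SHEAR-LETTER (same line).  `--kind proof --supports stmt-QuantumFields-27364 --as helper` (K1⁹ per dag-lead KEY MAP v2 ∕ GATE v1.69); count-neutral;
def-free.  [15] = T. Bałaban, Commun. Math. Phys. **102** (1985) 277–309 [Balaban1985Variational]; [6] = [Balaban1985RegularSpaces] (CMP **99** (1985) 75–102); [4] =
[Balaban1984PropagatorsII] (CMP **96** (1984) 223–250); [I.4] = [Balaban1984PropagatorsI] (CMP **95** (1984) 17–40); [3] = [Balaban1985Averaging] (CMP **98** (1985) 17–51);
[B5] = [Balaban1984PropagatorsI] (1.7) p. 18 (the radial contours).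

THE LOCATED POINT (cell bus I.36833, numbers).  FILE 7 §3 `localGaugeSplitOn_of_gauge152_recordShear_adm22_T4` and FILE 8's two doors size the record's shift family
`λ_j = ±log ĝ_j⁻¹` (`ĝ_j(y) := g_j(castSite lo_j)⁻¹·g_j(y)`, `g_j := u♮↾T^{(j)} = u♮ ∘ embIter j`) through dag-n07-w6's row (r4)
`N07ShearSizeTopBox.dist1_centredShear_le_box_record`: `dist1 ĝ_j(y) ≤ D_j·(v_j + a_j)` — a coordinate walk of `D_j := Σ_κ(hi_{j,κ} − lo_{j,κ})` steps times the
box's SUP letters (`v_j` for the axial data `M^j(U₁^{u♮})`, `a_j` for the Landau copy's averages `M^j(U₁)`) — and therefore carry the binder `hDσ : D_j·(v_j + a_j) ≤ σ ≤ ½`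
at EVERY level `j ≤ K − n`.  At the S6 head's canonical boxes `D_j ≤ d(M + 4ρ + 3)·L^{(K−n)−j}` (dag-n07-w4 `N07SplitClauseBoxesCubeDomains.width_levelBox_le`), while the
typed suppliers of the letters are level-UNIFORM (`a_j = 60ℓLR`, dag-n07-w6 `N07ShearSizeTopBoxChartA.dist1_iter_avOfRecord_le_of_chart`) or GROW downward
(`v_j ≥ v_{j+1} ≥ … ≥ v_k`, dag-n07-w6's (155)-down-the-tower ladder; [15] (151) is itself level-uniform): `hDσ` then asks `L^{(K−n)−j}·d(M + 4ρ + 3)·(v_k + a) ≤ ½`, a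
smallness in the tower's HEIGHT that no run letter supplies — the σ-editions are dischargeable at the top `O(log_L(1∕dMδ))` levels only.  What the clause really consumes
(FILE 7 §2 `…_coarseShift_levLift_under_adm22_T4`, binders `hsout` ∕ `hunder`) is only the SIZE of `λ` at the outer end-points of the `Λ_j`-cells and at the `Λ_i`-sites
under them, i.e. the VARIATION `dist1 ĝ_j(y)` of the gauge `u♮` between two fine sites of the cube `□̃` — uniformly small (the lineage's (166♭) factor) when telescoped with
PER-BOND letters along well-chosen paths (`dist1 (u(x)⁻¹u(x′)) ≤ Σ_{b ∈ P} (dist1 U′(b) + dist1 U₁(b))` by covariance: the Landau side costs `|P|·1.01ηt ≤ 1.01·d(M+4ρ+3)·t`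
from S3's unweighted (152) letter since `η·L^{K−n} = 1`; the axial side is `0` on the radial tower's tree bonds and pays only at block-face crossings — the DATA ∕ (r4) lane's
supplier, dag-n07-w6's radial tower + dag-n07-w5's crossing engines; NOT typed here).  THIS FILE re-keys the record door on that variation letter `ς` and provides the
per-bond path socket.

WHAT IS PROVED (sorry-free; no definition; axioms standard).
* §1 (generic torus `P`, gauge group `G`, averaging family `av`) ★ `dist1_toMS_path_le_sum` — n07-e module 43's chain `Node00.ShearedDatumCentred.dist1_toMS_path_le` with
  PER-BOND letters: along a coarse path `γ₀, …, γ_n` carried by bonds `c_i` (either orientation), `dist1 (g(γ₀)·g(γ_n)⁻¹) ≤ Σ_{i<n} (dist1 M^j(U₁^u)(c_i) + dist1 M^j(U₁)(c_i))`,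
  `g := u↾T^{(j)}` (`B11GaugeGlue.dist1_telescope`, sum form, ∘ `dist1_shear_step_le` ∘ `iter_apply_eq_toMS_conj`) · ★ `dist1_centredShear_le_of_path_sum` (the centred form
  `dist1 (g(y₀)⁻¹·g(y)) ≤ Σ …`) · `dist1_fine_path_le_sum` (level `0`: `dist1 (u(x₀)·u(x_n)⁻¹) ≤ Σ_{i<n} (dist1 U₁^u(b_i) + dist1 U₁(b_i))` — the FINE-path socket) ·
  `dist1_centredShear_le_of_fineVariation` (`u↾T^{(j)} = u ∘ embIter j`: a variation bound for `u` on a fine site set `S` bounds every level's centred shear whose representatives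
  lie in `S`) · A6 `centredShear_one` ∕ `fineVariation_one` (at `u = 1` both letters vanish).
* §2 (NODE 00's four-tori; by name over FILE 7 §2) ★★★ `localGaugeSplitOn_of_gauge152_recordShearVariation_dominated_adm22_T4 F N` — FILE 8's
  `…_recordShear_dominated_adm22_T4` VERBATIM except that the Landau copy `U₁`, the letters `v a : ℕ → ℝ`, `σ` and the binders `hv0 ha0 hσ hDσ hv ha` are REPLACED by ONE
  variation letter: `0 ≤ ς ≤ ½` and `hvar : ∀ j ≤ K − n, ∀ y ∈ castSite '' [lo_j, hi_j], dist1 (g_j(castSite lo_j)⁻¹·g_j(y)) ≤ ς` (same per-level boxes, same three GEOMETRY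
  binders — dag-n07-w4's p627154 `levelBoxes_cubeDomains` discharges them verbatim —, same dominated family binder `‖λ_j(y)‖ ≤ ‖log ĝ_j(y)⁻¹‖`, same datum, S3 gauge and
  (159)-splitting): `LocalGaugeSplitOn Y η_{K−n} t (t₁ + (t₂ + t_∂) + t₃) U` for EVERY `t_∂ > 2CB₃·(4ς)` (`‖log ĝ⁻¹‖ ≤ 2·dist1 ĝ⁻¹ = 2·dist1 ĝ ≤ 2ς` by
  `MatrixLog.norm_mlog_le_two_mul` and `dist1_inv`, then FILE 7 §2 with `s := 2ς`) · ★★ `…_recordShearVariation_neg_adm22_T4` (the (r1) orientation `λ_j := −log ĝ_j⁻¹`) ·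
  ★★★ `…_recordShearFineVariation_dominated_adm22_T4` (THE FINE FORM — the shape the covariance ∕ path supplier proves directly, no per-level corner: a fine site set `S` with
  `hvarU : ∀ x x′ ∈ S, dist1 (u♮(x)⁻¹·u♮(x′)) ≤ ς` and `hS : ∀ j ≤ K − n, ∀ y ∈ box_j, embIter j y ∈ S`).
* §3 ★ `centredShearVariation_le_of_box_letters_record` — FILE 8's crude instance RECOVERED: per-level box letters `hv, ha` with `D_j·(v_j + a_j) ≤ σ` give `hvar` with
  `ς := σ` (`dist1_centredShear_le_box_record`) — the short-tower case of §2; nothing landed is wasted.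
HONEST SCOPE.  Count-neutral re-keying + group-algebra bookkeeping; the VALUE of `ς` at the record (the sharp supplier along radial-tower paths) is NOT typed here and is the
data ∕ (r4) lane's; DISPLAYED, not discharged: `ς`, the gauge `u♮` (the head's `u⁻¹` of [6] Thm 2), S3's (152) letters, the (159)-splitting and its three letters, P12's tower ∕
window hypotheses, the box-membership facts.  Nothing of [15]∕[6]∕[4]∕[3]∕[B5] ANALYSIS asserted; `LocalLettersSplitTopStepCore(G∕R)` ∕ `DatumGaugeSplitTopStepCore(G∕R)` ∕
`HalvingStepTop(Core)` ∕ `stub_prop8StepCoP13` NOT discharged; K0⁷ ∕ K1⁹ NOT closed; N07 NOT discharged; counts unmoved (typed 28∕28 · discharged 5∕27); one finite 𝕋⁴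
programme at fixed ε — the route closes the conditional finite-𝕋⁴ rung `BalabanLadder.UV` ONLY; the YM mass gap (Clay) is NOT proved by any of this; nothing continuum ∕ ℝ⁴ ∕
OS.  No `sorry`, no `def`, no `instance`, no `notation`.

RELATED IN THE TREE, NOT DUPLICATED (stem check 2026-08-28T11:30Z: `ls …/Theorems | rg -i 'ShearVariation|GaugeVariation'` = ∅; `rg 'toMS_path_le_sum|centredShear_le_of_path_sum'`
over lean∕ = ∅): n07-e module 43 `Node00.ShearedDatumCentred` (the constant-letter chain `dist1_toMS_path_le` ∕ `_le_of_reach` — CITED, the sum form is new); FILE 7 ∕ FILE 8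
(the σ-editions — CONSUMED ∕ recovered); dag-n07-w6 `N07ShearSizeTopBox` (row (r4) at the record — CITED in §3).

References: [15] (144) p. 300, (150)–(152) p. 301, (154)–(156) p. 302, (157)–(159) pp. 302–303, (161) p. 303, (164)–(165) p. 304, (168) p. 304; [3] (8), (11) p. 19,
(85)–(88) p. 31; [4] (2.1)–(2.4) p. 224, (2.35) p. 228, (2.60) p. 234, Cor. 2.8 (2.150)–(2.151) p. 249; [I.4] (1.7) p. 18, (1.18)–(1.20) p. 20; [6] Thm 2, (1.29)–(1.31) pp. 80–81.
-/

set_option autoImplicit false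

noncomputable section
open scoped BigOperators Matrix.Norms.L2Operator

namespace Summit.QuantumFields.YangMills.BalabanUVNodes.N07SplitClauseOfShearVariation

open Literature.MathematicalPhysics.QuantumFieldTheory.Balaban1983to89
open Literature.MathematicalPhysics.QuantumFieldTheory.Balaban1983to89.Node00
open Literature.MathematicalPhysics.QuantumFieldTheory.Balaban1983to89.B12RegularSpaces111 (gaugeU expI grad)
open B5Eq118OneStroke (iterBlockOf)
open B11Eq115Space (levOf)
open B6SectADomainsV1 (Domains)
open B6SectAOperatorsV1 (BondIdx)
open B15DeterminingSets (embIter)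
open B11GaugeGlue (dist1_telescope dist1_inv_mul_eq)
open T4Continuum (T4Family)
open T4AxialGaugeSmallField (castSite)
open B16Sect1Backgrounds (toMS)
open GaugeField (gaugeAct)
open MatrixLog (mlog norm_mlog_le_two_mul)
open Summit.QuantumFields.YangMills.Theorems.FlatCubeLevels (lamSite_levOf_inOm)
open Summit.QuantumFields.YangMills.Theorems.FlatCubeOpsText (Adm22)
open Summit.QuantumFields.YangMills.Theorems.K0FlatCubeOpsTextP (flatH IsLevWeight)
open Summit.QuantumFields.YangMills.BalabanUVNodes.N07HalvingStepTopOfLocalLetters (Letters10On)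
open Summit.QuantumFields.YangMills.BalabanUVNodes.N07LocalLettersSplitCore (LocalGaugeSplitOn)
open Summit.QuantumFields.YangMills.BalabanUVNodes.N07ShearSizeTopBox (dist1_centredShear_le_box_record)
open Summit.QuantumFields.YangMills.BalabanUVNodes.N07SplitClauseOfShearSize (iterBlockOf_levOf_mem_of_lamSite
  localGaugeSplitOn_of_gauge152_coarseShift_levLift_under_adm22_T4)

/-! ## §1  The shear's variation along a path with PER-BOND letters (generic torus, gauge group, averaging family) -/

section Path

variable {P : Params} {G : Type*} [GaugeGroup G] (av : ∀ i, Averaging P i G)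

/-- ★ **CHAIN WITH PER-BOND LETTERS** (n07-e module 43's `dist1_toMS_path_le` with the sum kept): let `γ₀, …, γ_n` be sites of `T^{(j)}` and `c₀, …, c_{n−1}` bonds of `T^{(j)}`,
`c_i` joining `γ_i` and `γ_{i+1}` in either orientation; then for EVERY gauge function `u` of `T_η` and every `U₁`, with `g := u↾T^{(j)}`,
`dist1 (g(γ₀)·g(γ_n)⁻¹) ≤ Σ_{i<n} (dist1 M^j(U₁^u)(c_i) + dist1 M^j(U₁)(c_i))` — covariance (`iter_apply_eq_toMS_conj`: `M^j(U₁)(c) = g(c₋)⁻¹·M^j(U₁^u)(c)·g(c₊)`), the one-bond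
increment `dist1_shear_step_le`, and the `dist1` telescope in SUM form (`B11GaugeGlue.dist1_telescope`).  The constant-letter chain of module 43 is the case of equal summands;
the point of the sum is that a supplier may charge each bond its OWN size (zero on the axial tree, the crossing letter at block faces).
[cite: Balaban1985Averaging, (8) p.19, (11) p.19; Balaban1985Variational, (151)–(152) p.301, (154) p.302] -/
theorem dist1_toMS_path_le_sum (u : GaugeTransf P 0 G) (U₁ : GaugeField P 0 G) {j : ℕ} (hj : j ≤ P.m + P.K) (γ : ℕ → Site P j) (c : ℕ → PBond P j) (n : ℕ)
    (hγ : ∀ i, i < n → ((c i).src = γ i ∧ (c i).tgt = γ (i + 1)) ∨ ((c i).src = γ (i + 1) ∧ (c i).tgt = γ i)) :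
    dist1 (toMS u j (γ 0) * (toMS u j (γ n))⁻¹) ≤
      ∑ i ∈ Finset.range n, (dist1 (Averaging.iter av j (gaugeAct u U₁) (c i)) + dist1 (Averaging.iter av j U₁ (c i))) := by
  refine (dist1_telescope (fun i => toMS u j (γ i)) n).trans (Finset.sum_le_sum fun i hi => ?_)
  have hrel := iter_apply_eq_toMS_conj av u U₁ hj (c i)
  rcases hγ i (Finset.mem_range.mp hi) with ⟨hs, ht⟩ | ⟨hs, ht⟩
  · rw [hs, ht] at hrel
    exact dist1_shear_step_le hrel.symm
  · rw [hs, ht] at hrel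
    exact dist1_shear_step_le_rev hrel.symm

/-- ★ **THE CENTRED SHEAR's VARIATION WITH PER-BOND LETTERS**: for a coarse path from `y₀` to `y` as in `dist1_toMS_path_le_sum`,
`dist1 (g(y₀)⁻¹·g(y)) ≤ Σ_{i<n} (dist1 M^j(U₁^u)(c_i) + dist1 M^j(U₁)(c_i))`, `g := u↾T^{(j)}`. [cite: Balaban1985Variational, (151)–(152) p.301, (154) p.302] -/
theorem dist1_centredShear_le_of_path_sum (u : GaugeTransf P 0 G) (U₁ : GaugeField P 0 G) {j : ℕ} (hj : j ≤ P.m + P.K) (γ : ℕ → Site P j) (c : ℕ → PBond P j)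
    (n : ℕ) (hγ : ∀ i, i < n → ((c i).src = γ i ∧ (c i).tgt = γ (i + 1)) ∨ ((c i).src = γ (i + 1) ∧ (c i).tgt = γ i))
    {y₀ y : Site P j} (h0 : γ 0 = y₀) (hn : γ n = y) :
    dist1 ((toMS u j y₀)⁻¹ * toMS u j y) ≤
      ∑ i ∈ Finset.range n, (dist1 (Averaging.iter av j (gaugeAct u U₁) (c i)) + dist1 (Averaging.iter av j U₁ (c i))) := by
  rw [dist1_inv_mul_eq, ← h0, ← hn]
  exact dist1_toMS_path_le_sum av u U₁ hj γ c n hγ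

omit av in
/-- **THE FINE-PATH SOCKET** (level `0`: `u↾T^{(0)} = u`, `M⁰ = id`): along a path `x₀, …, x_n` of `T_η` carried by fine bonds `b_i` (either orientation),
`dist1 (u(x₀)·u(x_n)⁻¹) ≤ Σ_{i<n} (dist1 U₁^u(b_i) + dist1 U₁(b_i))` — with `U′ := U₁^u` the axial representative and `U₁` the Landau copy this is the shape of the sharp supplier:
the Landau side pays `|P|·dist1`-of-a-fine-bond, the axial side pays bond by bond (nothing on tree bonds). [cite: Balaban1985Averaging, (8) p.19; Balaban1985Variational, (152) p.301, (154) p.302] -/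
theorem dist1_fine_path_le_sum (u : GaugeTransf P 0 G) (U₁ : GaugeField P 0 G) (γ : ℕ → Site P 0) (b : ℕ → PBond P 0) (n : ℕ)
    (hγ : ∀ i, i < n → ((b i).src = γ i ∧ (b i).tgt = γ (i + 1)) ∨ ((b i).src = γ (i + 1) ∧ (b i).tgt = γ i)) :
    dist1 (u (γ 0) * (u (γ n))⁻¹) ≤ ∑ i ∈ Finset.range n, (dist1 (gaugeAct u U₁ (b i)) + dist1 (U₁ (b i))) := by
  refine (dist1_telescope (fun i => u (γ i)) n).trans (Finset.sum_le_sum fun i hi => ?_)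
  -- covariance at one fine bond: `u(b₋)⁻¹·U₁^u(b)·u(b₊) = U₁(b)`
  have hrel : (u (b i).src)⁻¹ * gaugeAct u U₁ (b i) * u (b i).tgt = U₁ (b i) := by
    simp only [GaugeField.gaugeAct]; group
  rcases hγ i (Finset.mem_range.mp hi) with ⟨hs, ht⟩ | ⟨hs, ht⟩
  · rw [hs, ht] at hrel
    exact dist1_shear_step_le hrel
  · rw [hs, ht] at hrel
    exact dist1_shear_step_le_rev hrel

omit av in
/-- **`u↾T^{(j)} = u ∘ embIter j`** (`B16Sect1Backgrounds.toMS`): a variation bound for the FINE gauge function on a fine site set `S` — `dist1 (u(x)⁻¹·u(x′)) ≤ ς` for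
`x, x′ ∈ S` — bounds every level's centred shear whose two representatives lie in `S`: `dist1 (g_j(y₀)⁻¹·g_j(y)) ≤ ς`. [cite: Balaban1989LargeFieldII, (1.25) p.362 (bookkeeping); Balaban1985Variational, (152) p.301] -/
theorem dist1_centredShear_le_of_fineVariation (u : GaugeTransf P 0 G) {S : Set (Site P 0)} {ς : ℝ}
    (hvarU : ∀ x ∈ S, ∀ x' ∈ S, dist1 ((u x)⁻¹ * u x') ≤ ς) {j : ℕ} {y₀ y : Site P j} (h₀ : embIter j y₀ ∈ S) (h : embIter j y ∈ S) :
    dist1 ((toMS u j y₀)⁻¹ * toMS u j y) ≤ ς :=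
  hvarU _ h₀ _ h

omit av in
/-- A6: at the trivial gauge `u = 1` the centred shear is `1` at every level and site, so the variation letter holds with `ς = 0`.
[cite: Balaban1985Variational, (152) p.301 (bookkeeping)] -/
theorem centredShear_one (j : ℕ) (y₀ y : Site P j) :
    dist1 ((toMS (fun _ : Site P 0 => (1 : G)) j y₀)⁻¹ * toMS (fun _ : Site P 0 => (1 : G)) j y) = 0 := by
  have h1 : ∀ z : Site P j, toMS (fun _ : Site P 0 => (1 : G)) j z = 1 := fun _ => rfl
  rw [h1, h1, inv_one, one_mul]
  exact GaugeGroup.dist1_one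

omit av in
/-- A6, fine form: at `u = 1`, `dist1 (u(x)⁻¹·u(x′)) = 0` for all fine sites. [cite: Balaban1985Variational, (152) p.301 (bookkeeping)] -/
theorem fineVariation_one (x x' : Site P 0) :
    dist1 (((fun _ : Site P 0 => (1 : G)) x)⁻¹ * (fun _ : Site P 0 => (1 : G)) x') = 0 := by
  rw [inv_one, one_mul]
  exact GaugeGroup.dist1_one

end Path

/-! ## §2  NODE 00's four-tori: the record door keyed on the variation letter `ς` -/

section T4

variable (F : T4Family) (N : ℕ) [NeZero N]

/-- The log letter from the variation letter: in `SU(N) ⊂ M_N(ℂ)` (`dist1 = ‖· − 1‖_op`), `dist1 ĝ ≤ ς ≤ ½` gives `‖log ĝ⁻¹‖ ≤ 2ς`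
(`dist1 ĝ⁻¹ = dist1 ĝ`, `MatrixLog.norm_mlog_le_two_mul`). [cite: Balaban1985Averaging, (21) p.21; Balaban1985Variational, (152) p.301] -/
theorem norm_mlog_inv_le_of_dist1_le {g : SU N} {ς : ℝ} (hς : ς ≤ 1 / 2) (hg : dist1 g ≤ ς) :
    ‖mlog (((g⁻¹ : SU N)) : MatA N)‖ ≤ 2 * ς := by
  have h1 : dist1 (g⁻¹) ≤ ς := (GaugeGroup.dist1_inv g).trans_le hg
  have h2 : ‖(((g⁻¹ : SU N)) : MatA N) - 1‖ ≤ ς := h1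
  exact (norm_mlog_le_two_mul (h2.trans hς)).trans (mul_le_mul_of_nonneg_left h2 (by norm_num))

open scoped Classical in
/-- ★★★ **THE R0′ SPLIT CLAUSE AT THE RECORD, KEYED ON THE SHEAR's VARIATION LETTER.**  FILE 8's `localGaugeSplitOn_of_gauge152_recordShear_dominated_adm22_T4` verbatim
except that the per-level box letters `v_j, a_j`, the uniform `σ` and `hDσ : D_j·(v_j + a_j) ≤ σ` — the «sup letter × walk length» supplier — are replaced by ONE letter:
`0 ≤ ς ≤ ½` with `hvar : ∀ j ≤ K − n, ∀ y ∈ castSite '' [lo_j, hi_j], dist1 (g_j(castSite lo_j)⁻¹·g_j(y)) ≤ ς`, `g_j := u♮↾T^{(j)}` (the variation of the gauge `u♮` — the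
head's `u⁻¹` of [6] Thm 2 — between the box corner's and `y`'s representative fine sites).  Binders: averaging of record, torus `K`, height `1 ≤ K − n`, admissible tower `D`
with level weights, window `Y`, componentwise extension `H_V` of `flatH`; the gauge `u♮`; per-level boxes `[lo_j, hi_j]`; GEOMETRY (DISPLAYED — dag-n07-w4's
`levelBoxes_cubeDomains` at the canonical boxes): outer end-points of `Λ_j`-cells in the level-`j` box, `Λ_j`-sites in it for `j ≥ 1`, fine `Λ₀`-sites under outer end-points
in the level-`0` box; the shift family `λ` DOMINATED by the letter family, `‖λ_j(y)‖ ≤ ‖log ĝ_j(y)⁻¹‖`; `X` its coarse gradient (factor `L^{K−n}∕L^{j(c)}`); S3's gauge of `U`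
on `Y` with (152) letters `t`; the (159)-splitting `A − H_V X = A₁ + A₂ − A₃` with letters `t₁, t₂, t₃`.  Conclusion: `LocalGaugeSplitOn Y η_{K−n} t (t₁ + (t₂ + t_∂) + t₃) U`
for EVERY `t_∂ > 2CB₃·(4ς)` (∘ FILE 7 §2's sharp door with `s := 2ς`).  The supplier of `ς` is free to telescope PER-BOND letters along any paths (§1).
[cite: Balaban1985Variational, (144) p.300, (150)–(152) p.301, (157)–(159) pp.302–303, (161) p.303, (164)–(165) p.304, (168) p.304; Balaban1985Averaging, (85)–(88) p.31; Balaban1984PropagatorsII, (2.1)–(2.4) p.224, (2.35) p.228, (2.60) p.234, Cor. 2.8 (2.150)–(2.151) p.249; Balaban1984PropagatorsI, (1.18)–(1.20) p.20] -/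
theorem localGaugeSplitOn_of_gauge152_recordShearVariation_dominated_adm22_T4 :
    ∃ (Mh₀ R₀ : ℕ) (C δ₀ δ₁ B₃ : ℝ), 0 ≤ C ∧ 0 < δ₀ ∧ 0 < δ₁ ∧ 0 < B₃ ∧
    ∀ (n K : ℕ) (_ : 1 ≤ K - n) (_ : K - n + 1 ≤ F.m + K) {Mh R a' : ℕ} (_ : Mh = F.L ^ a') (_ : Mh₀ ≤ Mh) (_ : R₀ ≤ R) (_ : a' + 3 ≤ F.m + n)
      (D : Domains (F.P K)) (_ : D.k = K - n) (_ : Adm22 D R (F.L * Mh))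
      (w : ℕ → PBond (F.P K) 0 → ℝ) (_ : IsLevWeight (F.P K) (K - n) D w)
      {Y : Set (Site (F.P K) 0)} (_ : ∀ x ∈ Y, D.InOm (K - n) x)
      {HV : (BondIdx D → MatA N) →ₗ[ℂ] (PBond (F.P K) 0 → MatA N)}
      (_ : ∀ (B : BondIdx D → MatA N) (b : PBond (F.P K) 0), HV B b = ∑ c, ((flatH (F.P K) (K - n) D (Pi.single c 1) b : ℝ) : ℂ) • B c)
      -- the gauge `u♮` of the (r1)+(r4) row, the per-level boxes and ONE variation letter
      (uL : GaugeTransf (F.P K) 0 (SU N)) (lo hi : ℕ → (Fin (F.P K).d → ℤ)) {ς : ℝ} (_ : 0 ≤ ς) (_ : ς ≤ 1 / 2)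
      (_ : ∀ j ≤ K - n, ∀ y : Site (F.P K) j, y ∈ (castSite '' Set.Icc (lo j) (hi j) : Set (Site (F.P K) j)) →
        dist1 ((toMS uL j (castSite (lo j)))⁻¹ * toMS uL j y) ≤ ς)
      -- GEOMETRY (displayed)
      (_ : ∀ c : BondIdx D,
        (c.1.2.src ∉ D.Om c.1.1 → c.1.2.src ∈ (castSite '' Set.Icc (lo c.1.1) (hi c.1.1) : Set (Site (F.P K) c.1.1))) ∧
        (c.1.2.tgt ∉ D.Om c.1.1 → c.1.2.tgt ∈ (castSite '' Set.Icc (lo c.1.1) (hi c.1.1) : Set (Site (F.P K) c.1.1))))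
      (_ : ∀ (j : ℕ), 1 ≤ j → ∀ y : Site (F.P K) j, D.LamSite j y → y ∈ (castSite '' Set.Icc (lo j) (hi j) : Set (Site (F.P K) j)))
      (_ : ∀ (c : BondIdx D) (x : Site (F.P K) 0),
        (c.1.2.src ∉ D.Om c.1.1 ∧ iterBlockOf c.1.1 x = c.1.2.src) ∨ (c.1.2.tgt ∉ D.Om c.1.1 ∧ iterBlockOf c.1.1 x = c.1.2.tgt) →
        D.LamSite 0 x → x ∈ (castSite '' Set.Icc (lo 0) (hi 0) : Set (Site (F.P K) 0)))
      -- the shift family, DOMINATED by the (r1) letter family, and its datum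
      (lam : (j : ℕ) → Site (F.P K) j → MatA N)
      (_ : ∀ (j : ℕ) (y : Site (F.P K) j), ‖lam j y‖ ≤ ‖mlog (((((toMS uL j (castSite (lo j)))⁻¹ * toMS uL j y)⁻¹ : SU N)) : MatA N)‖)
      {X : BondIdx D → MatA N}
      (_ : ∀ c : BondIdx D, X c = LatticeFieldCalculus.grad (((F.P K).L : ℝ) ^ (K - n) / ((F.P K).L : ℝ) ^ (c.1.1 : ℕ)) (lam c.1.1) c.1.2)
      -- S3's gauge of `U` on the window and the (159)-splitting of `A − H_V X`
      {U : GaugeField (F.P K) 0 (SU N)} (u : GaugeTransf (F.P K) 0 (SU N)) {A A₁ A₂ A₃ : PBond (F.P K) 0 → MatA N} {t t₁ t₂ t₃ : ℝ}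
      (_ : ∀ b ∈ (Sect2.regionOfSet (F.P K) Y).bonds,
        gaugeU (fun x => ιSU N (u x)) (fun b' => ιSU N (U b')) b = expI ((F.P K).eta (K - n)) (A b))
      (_ : ∀ b ∈ (Sect2.regionOfSet (F.P K) Y).bonds, ‖A b‖ < t)
      (_ : ∀ q ∈ (Sect2.regionOfSet (F.P K) Y).dpairs, ‖grad ((F.P K).eta (K - n)) q.2.1 (fun y => A ⟨y, q.2.2⟩) q.1‖ < t)
      (_ : ∀ b, A b - HV X b = A₁ b + A₂ b - A₃ b)
      (_ : Letters10On Y ((F.P K).eta (K - n)) t₁ A₁) (_ : Letters10On Y ((F.P K).eta (K - n)) t₂ A₂) (_ : Letters10On Y ((F.P K).eta (K - n)) t₃ A₃)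
      {tD : ℝ} (_ : 2 * C * B₃ * (4 * ς) < tD),
      LocalGaugeSplitOn Y ((F.P K).eta (K - n)) t (t₁ + (t₂ + tD) + t₃) U := by
  obtain ⟨Mh₀, R₀, C, δ₀, δ₁, B₃, hC, hδ₀, hδ₁, hB₃, hmain⟩ := localGaugeSplitOn_of_gauge152_coarseShift_levLift_under_adm22_T4 F N
  refine ⟨Mh₀, R₀, C, δ₀, δ₁, B₃, hC, hδ₀, hδ₁, hB₃, ?_⟩
  intro n K hk1 hk' Mh R a' hMha hMh hR hsize D hDk hAdm w hw Y hY HV hHV uL lo hi ς hς0 hς hvar hboxO hboxS hbox0 lam hlam X hX U u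
    A A₁ A₂ A₃ t t₁ t₂ t₃ he hA hdA h159 h₁ h₂ h₃ tD htD
  -- the size of any dominated family on the level-`j` box, `j ≤ K − n`
  have hlamS : ∀ (j : ℕ) (_ : j ≤ K - n) (y : Site (F.P K) j), y ∈ (castSite '' Set.Icc (lo j) (hi j) : Set (Site (F.P K) j)) →
      ‖lam j y‖ ≤ 2 * ς :=
    fun j hj y hy => (hlam j y).trans (norm_mlog_inv_le_of_dist1_le N hς (hvar j hj y hy))
  have hs0 : 0 ≤ 2 * ς := by positivity
  have hsout : ∀ c : BondIdx D, (c.1.2.src ∉ D.Om c.1.1 → ‖lam c.1.1 c.1.2.src‖ ≤ 2 * ς) ∧ (c.1.2.tgt ∉ D.Om c.1.1 → ‖lam c.1.1 c.1.2.tgt‖ ≤ 2 * ς) :=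
    fun c => ⟨fun h => hlamS _ ((D.le_of_lamBond c.2).trans hDk.le) _ ((hboxO c).1 h),
      fun h => hlamS _ ((D.le_of_lamBond c.2).trans hDk.le) _ ((hboxO c).2 h)⟩
  have hunder : ∀ (c : BondIdx D) (x : Site (F.P K) 0),
      (c.1.2.src ∉ D.Om c.1.1 ∧ iterBlockOf c.1.1 x = c.1.2.src) ∨ (c.1.2.tgt ∉ D.Om c.1.1 ∧ iterBlockOf c.1.1 x = c.1.2.tgt) →
      ‖lam (levOf (fun i => {z : Site (F.P K) 0 | D.InOm i z}) D.k x) (iterBlockOf (levOf (fun i => {z : Site (F.P K) 0 | D.InOm i z}) D.k x) x)‖ ≤ 2 * ς := by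
    intro c x hx
    have hmem := iterBlockOf_levOf_mem_of_lamSite D (fun j => (castSite '' Set.Icc (lo j) (hi j) : Set (Site (F.P K) j))) x hboxS (hbox0 c x hx)
    exact hlamS _ ((D.le_of_lamSite (lamSite_levOf_inOm D x)).trans hDk.le) _ hmem
  have htD' : 2 * C * B₃ * (2 * ς + 2 * ς) < tD := by
    have : 2 * ς + 2 * ς = 4 * ς := by ring
    rw [this]; exact htD
  exact hmain n K hk1 hk' hMha hMh hR hsize D hDk hAdm w hw hY hHV lam hs0 hsout hunder hX u he hA hdA h159 h₁ h₂ h₃ htD'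

open scoped Classical in
/-- ★★ **THE (r1) ORIENTATION, variation-keyed**: the same door for the family `λ_j(y) = −log ĝ_j(y)⁻¹` (the shift summand of dag-n07-w6's composed row (r1)+(r4) in
potential units; `‖−Z‖ = ‖Z‖`). [cite: Balaban1985Variational, (152) p.301, (154)–(156) pp.301–302, (157)–(159) pp.302–303, (164)–(165) p.304, (168) p.304; Balaban1985Averaging, (85)–(88) p.31; Balaban1984PropagatorsII, (2.3) p.224, Cor. 2.8 (2.150)–(2.151) p.249; Balaban1984PropagatorsI, (1.20) p.20] -/
theorem localGaugeSplitOn_of_gauge152_recordShearVariation_neg_adm22_T4 :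
    ∃ (Mh₀ R₀ : ℕ) (C δ₀ δ₁ B₃ : ℝ), 0 ≤ C ∧ 0 < δ₀ ∧ 0 < δ₁ ∧ 0 < B₃ ∧
    ∀ (n K : ℕ) (_ : 1 ≤ K - n) (_ : K - n + 1 ≤ F.m + K) {Mh R a' : ℕ} (_ : Mh = F.L ^ a') (_ : Mh₀ ≤ Mh) (_ : R₀ ≤ R) (_ : a' + 3 ≤ F.m + n)
      (D : Domains (F.P K)) (_ : D.k = K - n) (_ : Adm22 D R (F.L * Mh))
      (w : ℕ → PBond (F.P K) 0 → ℝ) (_ : IsLevWeight (F.P K) (K - n) D w)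
      {Y : Set (Site (F.P K) 0)} (_ : ∀ x ∈ Y, D.InOm (K - n) x)
      {HV : (BondIdx D → MatA N) →ₗ[ℂ] (PBond (F.P K) 0 → MatA N)}
      (_ : ∀ (B : BondIdx D → MatA N) (b : PBond (F.P K) 0), HV B b = ∑ c, ((flatH (F.P K) (K - n) D (Pi.single c 1) b : ℝ) : ℂ) • B c)
      (uL : GaugeTransf (F.P K) 0 (SU N)) (lo hi : ℕ → (Fin (F.P K).d → ℤ)) {ς : ℝ} (_ : 0 ≤ ς) (_ : ς ≤ 1 / 2)
      (_ : ∀ j ≤ K - n, ∀ y : Site (F.P K) j, y ∈ (castSite '' Set.Icc (lo j) (hi j) : Set (Site (F.P K) j)) →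
        dist1 ((toMS uL j (castSite (lo j)))⁻¹ * toMS uL j y) ≤ ς)
      (_ : ∀ c : BondIdx D,
        (c.1.2.src ∉ D.Om c.1.1 → c.1.2.src ∈ (castSite '' Set.Icc (lo c.1.1) (hi c.1.1) : Set (Site (F.P K) c.1.1))) ∧
        (c.1.2.tgt ∉ D.Om c.1.1 → c.1.2.tgt ∈ (castSite '' Set.Icc (lo c.1.1) (hi c.1.1) : Set (Site (F.P K) c.1.1))))
      (_ : ∀ (j : ℕ), 1 ≤ j → ∀ y : Site (F.P K) j, D.LamSite j y → y ∈ (castSite '' Set.Icc (lo j) (hi j) : Set (Site (F.P K) j)))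
      (_ : ∀ (c : BondIdx D) (x : Site (F.P K) 0),
        (c.1.2.src ∉ D.Om c.1.1 ∧ iterBlockOf c.1.1 x = c.1.2.src) ∨ (c.1.2.tgt ∉ D.Om c.1.1 ∧ iterBlockOf c.1.1 x = c.1.2.tgt) →
        D.LamSite 0 x → x ∈ (castSite '' Set.Icc (lo 0) (hi 0) : Set (Site (F.P K) 0)))
      (lam : (j : ℕ) → Site (F.P K) j → MatA N)
      (_ : ∀ (j : ℕ) (y : Site (F.P K) j), lam j y = -mlog (((((toMS uL j (castSite (lo j)))⁻¹ * toMS uL j y)⁻¹ : SU N)) : MatA N))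
      {X : BondIdx D → MatA N}
      (_ : ∀ c : BondIdx D, X c = LatticeFieldCalculus.grad (((F.P K).L : ℝ) ^ (K - n) / ((F.P K).L : ℝ) ^ (c.1.1 : ℕ)) (lam c.1.1) c.1.2)
      {U : GaugeField (F.P K) 0 (SU N)} (u : GaugeTransf (F.P K) 0 (SU N)) {A A₁ A₂ A₃ : PBond (F.P K) 0 → MatA N} {t t₁ t₂ t₃ : ℝ}
      (_ : ∀ b ∈ (Sect2.regionOfSet (F.P K) Y).bonds,
        gaugeU (fun x => ιSU N (u x)) (fun b' => ιSU N (U b')) b = expI ((F.P K).eta (K - n)) (A b))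
      (_ : ∀ b ∈ (Sect2.regionOfSet (F.P K) Y).bonds, ‖A b‖ < t)
      (_ : ∀ q ∈ (Sect2.regionOfSet (F.P K) Y).dpairs, ‖grad ((F.P K).eta (K - n)) q.2.1 (fun y => A ⟨y, q.2.2⟩) q.1‖ < t)
      (_ : ∀ b, A b - HV X b = A₁ b + A₂ b - A₃ b)
      (_ : Letters10On Y ((F.P K).eta (K - n)) t₁ A₁) (_ : Letters10On Y ((F.P K).eta (K - n)) t₂ A₂) (_ : Letters10On Y ((F.P K).eta (K - n)) t₃ A₃)
      {tD : ℝ} (_ : 2 * C * B₃ * (4 * ς) < tD),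
      LocalGaugeSplitOn Y ((F.P K).eta (K - n)) t (t₁ + (t₂ + tD) + t₃) U := by
  obtain ⟨Mh₀, R₀, C, δ₀, δ₁, B₃, hC, hδ₀, hδ₁, hB₃, hmain⟩ := localGaugeSplitOn_of_gauge152_recordShearVariation_dominated_adm22_T4 F N
  refine ⟨Mh₀, R₀, C, δ₀, δ₁, B₃, hC, hδ₀, hδ₁, hB₃, ?_⟩
  intro n K hk1 hk' Mh R a' hMha hMh hR hsize D hDk hAdm w hw Y hY HV hHV uL lo hi ς hς0 hς hvar hboxO hboxS hbox0 lam hlam X hX U u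
    A A₁ A₂ A₃ t t₁ t₂ t₃ he hA hdA h159 h₁ h₂ h₃ tD htD
  exact hmain n K hk1 hk' hMha hMh hR hsize D hDk hAdm w hw hY hHV uL lo hi hς0 hς hvar hboxO hboxS hbox0 lam
    (fun j y => by rw [hlam j y, norm_neg]) hX u he hA hdA h159 h₁ h₂ h₃ htD

open scoped Classical in
/-- ★★★ **THE FINE FORM** — the shape a covariance ∕ path supplier proves directly, with NO per-level corner: the variation of the gauge `u♮` on a fine site set `S ⊆ T_η`,
`hvarU : ∀ x x′ ∈ S, dist1 (u♮(x)⁻¹·u♮(x′)) ≤ ς` (`0 ≤ ς ≤ ½`), together with `hS : ∀ j ≤ K − n, ∀ y ∈ castSite '' [lo_j, hi_j], embIter j y ∈ S` (the level-`j` boxes'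
representative fine sites lie in `S` — at the head's canonical boxes `S :=` the fine collar cube `□̃`), gives the box-form letter `hvar` of
`localGaugeSplitOn_of_gauge152_recordShearVariation_dominated_adm22_T4` (`u♮↾T^{(j)} = u♮ ∘ embIter j`; the corner `castSite lo_j` lies in its own box as soon as the box
meets a site), hence the clause for every `t_∂ > 2CB₃·(4ς)`.  All other binders verbatim. [cite: Balaban1985Variational, (144) p.300, (150)–(152) p.301, (157)–(159) pp.302–303, (161) p.303, (164)–(165) p.304, (168) p.304; Balaban1985Averaging, (8) p.19, (85)–(88) p.31; Balaban1984PropagatorsII, (2.1)–(2.4) p.224, Cor. 2.8 (2.150)–(2.151) p.249; Balaban1984PropagatorsI, (1.18)–(1.20) p.20] -/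
theorem localGaugeSplitOn_of_gauge152_recordShearFineVariation_dominated_adm22_T4 :
    ∃ (Mh₀ R₀ : ℕ) (C δ₀ δ₁ B₃ : ℝ), 0 ≤ C ∧ 0 < δ₀ ∧ 0 < δ₁ ∧ 0 < B₃ ∧
    ∀ (n K : ℕ) (_ : 1 ≤ K - n) (_ : K - n + 1 ≤ F.m + K) {Mh R a' : ℕ} (_ : Mh = F.L ^ a') (_ : Mh₀ ≤ Mh) (_ : R₀ ≤ R) (_ : a' + 3 ≤ F.m + n)
      (D : Domains (F.P K)) (_ : D.k = K - n) (_ : Adm22 D R (F.L * Mh))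
      (w : ℕ → PBond (F.P K) 0 → ℝ) (_ : IsLevWeight (F.P K) (K - n) D w)
      {Y : Set (Site (F.P K) 0)} (_ : ∀ x ∈ Y, D.InOm (K - n) x)
      {HV : (BondIdx D → MatA N) →ₗ[ℂ] (PBond (F.P K) 0 → MatA N)}
      (_ : ∀ (B : BondIdx D → MatA N) (b : PBond (F.P K) 0), HV B b = ∑ c, ((flatH (F.P K) (K - n) D (Pi.single c 1) b : ℝ) : ℂ) • B c)
      -- the gauge `u♮`, ONE variation letter on a fine site set `S`, the per-level boxes with representatives in `S`
      (uL : GaugeTransf (F.P K) 0 (SU N)) {S : Set (Site (F.P K) 0)} {ς : ℝ} (_ : 0 ≤ ς) (_ : ς ≤ 1 / 2)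
      (_ : ∀ x ∈ S, ∀ x' ∈ S, dist1 ((uL x)⁻¹ * uL x') ≤ ς)
      (lo hi : ℕ → (Fin (F.P K).d → ℤ))
      (_ : ∀ j ≤ K - n, ∀ y : Site (F.P K) j, y ∈ (castSite '' Set.Icc (lo j) (hi j) : Set (Site (F.P K) j)) → embIter j y ∈ S)
      -- GEOMETRY (displayed)
      (_ : ∀ c : BondIdx D,
        (c.1.2.src ∉ D.Om c.1.1 → c.1.2.src ∈ (castSite '' Set.Icc (lo c.1.1) (hi c.1.1) : Set (Site (F.P K) c.1.1))) ∧
        (c.1.2.tgt ∉ D.Om c.1.1 → c.1.2.tgt ∈ (castSite '' Set.Icc (lo c.1.1) (hi c.1.1) : Set (Site (F.P K) c.1.1))))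
      (_ : ∀ (j : ℕ), 1 ≤ j → ∀ y : Site (F.P K) j, D.LamSite j y → y ∈ (castSite '' Set.Icc (lo j) (hi j) : Set (Site (F.P K) j)))
      (_ : ∀ (c : BondIdx D) (x : Site (F.P K) 0),
        (c.1.2.src ∉ D.Om c.1.1 ∧ iterBlockOf c.1.1 x = c.1.2.src) ∨ (c.1.2.tgt ∉ D.Om c.1.1 ∧ iterBlockOf c.1.1 x = c.1.2.tgt) →
        D.LamSite 0 x → x ∈ (castSite '' Set.Icc (lo 0) (hi 0) : Set (Site (F.P K) 0)))
      -- the shift family, DOMINATED by the (r1) letter family, and its datum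
      (lam : (j : ℕ) → Site (F.P K) j → MatA N)
      (_ : ∀ (j : ℕ) (y : Site (F.P K) j), ‖lam j y‖ ≤ ‖mlog (((((toMS uL j (castSite (lo j)))⁻¹ * toMS uL j y)⁻¹ : SU N)) : MatA N)‖)
      {X : BondIdx D → MatA N}
      (_ : ∀ c : BondIdx D, X c = LatticeFieldCalculus.grad (((F.P K).L : ℝ) ^ (K - n) / ((F.P K).L : ℝ) ^ (c.1.1 : ℕ)) (lam c.1.1) c.1.2)
      -- S3's gauge of `U` on the window and the (159)-splitting of `A − H_V X`
      {U : GaugeField (F.P K) 0 (SU N)} (u : GaugeTransf (F.P K) 0 (SU N)) {A A₁ A₂ A₃ : PBond (F.P K) 0 → MatA N} {t t₁ t₂ t₃ : ℝ}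
      (_ : ∀ b ∈ (Sect2.regionOfSet (F.P K) Y).bonds,
        gaugeU (fun x => ιSU N (u x)) (fun b' => ιSU N (U b')) b = expI ((F.P K).eta (K - n)) (A b))
      (_ : ∀ b ∈ (Sect2.regionOfSet (F.P K) Y).bonds, ‖A b‖ < t)
      (_ : ∀ q ∈ (Sect2.regionOfSet (F.P K) Y).dpairs, ‖grad ((F.P K).eta (K - n)) q.2.1 (fun y => A ⟨y, q.2.2⟩) q.1‖ < t)
      (_ : ∀ b, A b - HV X b = A₁ b + A₂ b - A₃ b)
      (_ : Letters10On Y ((F.P K).eta (K - n)) t₁ A₁) (_ : Letters10On Y ((F.P K).eta (K - n)) t₂ A₂) (_ : Letters10On Y ((F.P K).eta (K - n)) t₃ A₃)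
      {tD : ℝ} (_ : 2 * C * B₃ * (4 * ς) < tD),
      LocalGaugeSplitOn Y ((F.P K).eta (K - n)) t (t₁ + (t₂ + tD) + t₃) U := by
  obtain ⟨Mh₀, R₀, C, δ₀, δ₁, B₃, hC, hδ₀, hδ₁, hB₃, hmain⟩ := localGaugeSplitOn_of_gauge152_recordShearVariation_dominated_adm22_T4 F N
  refine ⟨Mh₀, R₀, C, δ₀, δ₁, B₃, hC, hδ₀, hδ₁, hB₃, ?_⟩
  intro n K hk1 hk' Mh R a' hMha hMh hR hsize D hDk hAdm w hw Y hY HV hHV uL S ς hς0 hς hvarU lo hi hS hboxO hboxS hbox0 lam hlam X hX U u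
    A A₁ A₂ A₃ t t₁ t₂ t₃ he hA hdA h159 h₁ h₂ h₃ tD htD
  -- the box corner is a box site as soon as the box meets a site, so its representative lies in `S` too
  have hvar : ∀ j ≤ K - n, ∀ y : Site (F.P K) j, y ∈ (castSite '' Set.Icc (lo j) (hi j) : Set (Site (F.P K) j)) →
      dist1 ((toMS uL j (castSite (lo j)))⁻¹ * toMS uL j y) ≤ ς := by
    intro j hj y hy
    have hlo : (castSite (lo j) : Site (F.P K) j) ∈ (castSite '' Set.Icc (lo j) (hi j) : Set (Site (F.P K) j)) := by
      obtain ⟨z, hz, -⟩ := hy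
      exact ⟨lo j, ⟨le_rfl, hz.1.trans hz.2⟩, rfl⟩
    exact dist1_centredShear_le_of_fineVariation uL hvarU (hS j hj _ hlo) (hS j hj y hy)
  exact hmain n K hk1 hk' hMha hMh hR hsize D hDk hAdm w hw hY hHV uL lo hi hς0 hς hvar hboxO hboxS hbox0 lam hlam hX u he hA hdA h159 h₁ h₂ h₃ htD

end T4

/-! ## §3  The crude instance recovered: FILE 8's box letters give the variation letter with `ς := σ` -/

section Recovered

variable (F : T4Family) (N : ℕ) [NeZero N]

/-- ★ **FILE 8's supplier as an instance of §2's letter**: per-level box bond letters `v_j` (data `M^j(U₁^{u♮})`) and `a_j` (averages `M^j(U₁)`) with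
`D_j·(v_j + a_j) ≤ σ` at the levels `j ≤ k` give `hvar` with `ς := σ` — dag-n07-w6's row (r4) `dist1_centredShear_le_box_record` (a coordinate walk of `D_j` steps times the
sup letters).  This is the SHORT-TOWER case of the door: at the head's canonical boxes `D_j ≤ d(M + 4ρ + 3)L^{k−j}`, so with level-uniform `v, a` the hypothesis `hDσ` holds only
for `L^{k}·d(M + 4ρ + 3)(v + a) ≤ σ`. [cite: Balaban1985Variational, (151)–(152) p.301] -/
theorem centredShearVariation_le_of_box_letters_record (K k : ℕ) (hk : k ≤ (F.P K).m + (F.P K).K) (uL : GaugeTransf (F.P K) 0 (SU N))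
    (U₁ : GaugeField (F.P K) 0 (SU N)) (lo hi : ℕ → (Fin (F.P K).d → ℤ)) (v a : ℕ → ℝ) {σ : ℝ}
    (hv0 : ∀ j, 0 ≤ v j) (ha0 : ∀ j, 0 ≤ a j)
    (hDσ : ∀ j ≤ k, ((∑ κ, (hi j κ - lo j κ).toNat : ℕ) : ℝ) * (v j + a j) ≤ σ)
    (hv : ∀ j ≤ k, ∀ c : PBond (F.P K) j, c.src ∈ (castSite '' Set.Icc (lo j) (hi j) : Set (Site (F.P K) j)) →
      c.tgt ∈ (castSite '' Set.Icc (lo j) (hi j) : Set (Site (F.P K) j)) → dist1 (Averaging.iter (avOfRecord F N K) j (gaugeAct uL U₁) c) ≤ v j)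
    (ha : ∀ j ≤ k, ∀ c : PBond (F.P K) j, c.src ∈ (castSite '' Set.Icc (lo j) (hi j) : Set (Site (F.P K) j)) →
      c.tgt ∈ (castSite '' Set.Icc (lo j) (hi j) : Set (Site (F.P K) j)) → dist1 (Averaging.iter (avOfRecord F N K) j U₁ c) ≤ a j) :
    ∀ j ≤ k, ∀ y : Site (F.P K) j, y ∈ (castSite '' Set.Icc (lo j) (hi j) : Set (Site (F.P K) j)) →
      dist1 ((toMS uL j (castSite (lo j)))⁻¹ * toMS uL j y) ≤ σ :=
  fun j hj _ hy => (dist1_centredShear_le_box_record F N K uL U₁ (hj.trans hk) (hv0 j) (ha0 j) (hv j hj) (ha j hj) hy).trans (hDσ j hj)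

end Recovered

end Summit.QuantumFields.YangMills.BalabanUVNodes.N07SplitClauseOfShearVariation

end
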